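import Summits.QuantumFields.YangMills.Theorems.LangevinControlUVOSLegsFromFemtoAndGapDefs
import Summits.QuantumFields.YangMills.Theorems.PencilRigidityDiagonalMirrorRPRStubRpClosureSupport
import HarnessLib

/-!
# Crux `NT` / seam `UVSeamRec.stub_floorsEngine` (S-B), conjunct 3: FEYNMAN–HELLMANN SLAB SKEWNESS — the three-point
# conjunct from the two-point floor, a slab transport law and mass shrinkage (card `feynman-hellmann-slab-skewness`)

Helper file (`--supports stmt-QuantumFields-20043`; owner RULINGS R78/R87) of the fleet lead `ym-spine-19353-p1`
(three-point-conjunct supplier of record, R78 (3)), kernel-checking in the tree, DEF-FREE, crux-ideate card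
`feynman-hellmann-slab-skewness` (seat `ym-cruxidea-19353-2` g11, HOME sketch `SlabSkewness.lean`, rc 0).
WHICH CLAUSE IT SUPPLIES: conjunct 3 (three-point floor) of the REGISTERED `UVSeamRec.stub_floorsEngine` from the
conjunct-2 floor `ε ≤ Q2(θv, v)` in MIRROR-SLAB shape plus two IR/spectral inputs, typed as hypotheses (no `def`):

* (ST) SLAB TRANSPORT `|Q3(θv, v, h) − n(β)·μ(β,L)·Q2(θv, v)| ≤ τ·Q2(θv, v)` — the Feynman–Hellmann / Michael action
  sum rule read as a three-point statement (`Q3 = ∂ₜ|₀ Q2^{(t·h)}`, tree `SkewResponse.hasDerivAt_tiltedQ2`; `h` a slab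
  bump between the mirror pair, `n(β)` its thickness in lattice units, `μ = −∂_β m̂` the mass-shrinkage rate);
* (MS) MASS SHRINKAGE `c ≤ n(β)·μ(β, L)` («asymptotic freedom from below»), with `τ < c`.

* §1 `mul_le_mul_of_logConvex`, `geometric_floor_of_logConvex` — range extension of a mirror floor along a log-convex
  chain (`εᵏ⁺¹ ≤ Cᵏ·m_{k+1}`): one floor + one ceiling propagate the floor to all depths at geometric rate.
* §2 `relSkewFloor_of_transport_of_shrinkage` — (ST) ∧ (MS) ∧ `0 ≤ Q2` ⇒ `(c − τ)·Q2(θv,v) ≤ Q3(θv, v, h)`;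
  `Q3_pos_of_slab` — the sign is POSITIVE (opposite to the squeezed-shape prediction of `SkewResponse`);
  `threePoint_floor_of_relSkewFloor` — `(c−τ)ε ≤ |Q3(θv, v, h)|`.
* §3 `threePointConjunct_of_slab` — conjunct 3 of `stub_floorsEngine` VERBATIM (compact witnesses `(θv, v, h)`,
  general `(G, r, a)`; at `(SU(2), rF)` it is the registered conjunct, to be paired with ANY conjunct-2 press-button).

HONEST FRAMING.  Packaging of two IR/spectral hypotheses (a one-particle transport law and mass shrinkage — not in
print as theorems for 4d Yang–Mills); arithmetic only; nothing about NT, the seam or a gap is asserted.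
[cite: GlimmJaffe1987, §6.1]
-/

set_option autoImplicit false

noncomputable section

open scoped SchwartzMap
open MeasureTheory Filter Topology
open Literature.MathematicalPhysics.QuantumFieldTheory Literature.MathematicalPhysics.QuantumLattice
open Literature.Probability.LatticeModels
open Summit.QuantumFields.YangMills.Cruxes.OSLegsFromFemtoAndGap.DlrCollarTransfer
open Summit.QuantumFields.YangMills.Cruxes.DiagonalMirrorRPR.ParityBridgeColdTraces.RpClosure (hasCompactSupport_thetaTest)

namespace Summit.QuantumFields.YangMills.Cruxes.NT.SlabSkewness


/-! ## §1 Range extension of a mirror floor along a log-convex chain -/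

/-- Ratios of a positive log-convex sequence increase: `m₁ · m_k ≤ m₀ · m_{k+1}`. [folklore] -/
theorem mul_le_mul_of_logConvex {m : ℕ → ℝ} (hpos : ∀ k, 0 < m k)
    (hconv : ∀ k, m (k + 1) ^ 2 ≤ m k * m (k + 2)) : ∀ k, m 1 * m k ≤ m 0 * m (k + 1) := by
  intro k
  induction k with
  | zero => simp [mul_comm]
  | succ k ih =>
    have hk1 := hpos (k + 1)
    have h1 : m 1 * m (k + 1) ^ 2 ≤ m 0 * m (k + 1) * m (k + 2) :=
      calc m 1 * m (k + 1) ^ 2 ≤ m 1 * (m k * m (k + 2)) := mul_le_mul_of_nonneg_left (hconv k) (hpos 1).le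
        _ = (m 1 * m k) * m (k + 2) := by ring
        _ ≤ (m 0 * m (k + 1)) * m (k + 2) := mul_le_mul_of_nonneg_right ih (hpos (k + 2)).le
        _ = m 0 * m (k + 1) * m (k + 2) := by ring
    have h2 : (m 1 * m (k + 1)) * m (k + 1) ≤ (m 0 * m (k + 1 + 1)) * m (k + 1) := by
      have : k + 1 + 1 = k + 2 := rfl
      rw [this]; nlinarith [h1]
    exact le_of_mul_le_mul_right h2 hk1

/-- **Geometric floor along a log-convex chain.**  A positive sequence with `m_{k+1}² ≤ m_k m_{k+2}` (for the
mirror values `m_k = Q2(θv_k, v_k)` of lattice time-translates: RP Cauchy–Schwarz + translation invariance), a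
CEILING `m₀ ≤ C` and a FLOOR `ε ≤ m₁` satisfies `ε^{k+1} ≤ C^k · m_{k+1}` for every `k`: the floor propagates to
all depths at geometric rate `ε/C` — a β-uniform upper bound on the decay rate from one floor and one ceiling.
[folklore] -/
theorem geometric_floor_of_logConvex {m : ℕ → ℝ} (hpos : ∀ k, 0 < m k)
    (hconv : ∀ k, m (k + 1) ^ 2 ≤ m k * m (k + 2)) {C ε : ℝ} (h0 : m 0 ≤ C) (h1 : ε ≤ m 1) (hε : 0 < ε) :
    ∀ k, ε ^ (k + 1) ≤ C ^ k * m (k + 1) := by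
  have hC : 0 < C := (hpos 0).trans_le h0
  intro k
  induction k with
  | zero => simpa using h1
  | succ k ih =>
    have hr := mul_le_mul_of_logConvex hpos hconv (k + 1)
    have hCk : 0 ≤ C ^ k := pow_nonneg hC.le k
    have hstep : ε * m (k + 1) ≤ C * m (k + 2) := by
      have : ε * m (k + 1) ≤ m 1 * m (k + 1) := mul_le_mul_of_nonneg_right h1 (hpos (k + 1)).le
      nlinarith [hpos (k + 2), this, hr]
    calc ε ^ (k + 1 + 1) = ε * ε ^ (k + 1) := by ring
      _ ≤ ε * (C ^ k * m (k + 1)) := mul_le_mul_of_nonneg_left ih hε.le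
      _ = C ^ k * (ε * m (k + 1)) := by ring
      _ ≤ C ^ k * (C * m (k + 2)) := mul_le_mul_of_nonneg_left hstep hCk
      _ = C ^ (k + 1) * m (k + 1 + 1) := by ring


/-! ## §2 The slab package ⇒ a signed relative skewness floor (def-free) -/

section Torus

variable (G : Type) [Group G] [TopologicalSpace G] [IsTopologicalGroup G] [CompactSpace G]
  [MeasurableSpace G] [BorelSpace G] (r : LatticeRep G) (a : ℝ → ℝ)

/-- **Transport + shrinkage ⇒ the signed relative skewness floor.**  If on every torus `Λ₅ ≤ aβ·L` at every
`β ≥ β₅`: `0 ≤ Q2(θv, v)` (e.g. from the clause-(i) floor), (ST) `|Q3(θv, v, h) − n β·μ β L·Q2(θv, v)| ≤ τ·Q2(θv, v)`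
and (MS) `c ≤ n β·μ β L`, then `(c − τ)·Q2(θv, v) ≤ Q3(θv, v, h)` there. [folklore] -/
theorem relSkewFloor_of_transport_of_shrinkage (v h : 𝓢(EuclideanSpace ℝ (Fin 4), ℝ)) (n : ℝ → ℝ)
    (μ : ℝ → ℕ → ℝ) {τ c β₅ Λ₅ : ℝ}
    (hnn : ∀ β : ℝ, β₅ ≤ β → ∀ L : ℕ, Λ₅ ≤ a β * L → 0 ≤ Q2 G r β L (a β) (thetaTest 4 v) v)
    (hT : ∀ β : ℝ, β₅ ≤ β → ∀ L : ℕ, Λ₅ ≤ a β * L →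
      |Q3 G r β L (a β) (thetaTest 4 v) v h - n β * μ β L * Q2 G r β L (a β) (thetaTest 4 v) v| ≤
        τ * Q2 G r β L (a β) (thetaTest 4 v) v)
    (hS : ∀ β : ℝ, β₅ ≤ β → ∀ L : ℕ, Λ₅ ≤ a β * L → c ≤ n β * μ β L) :
    ∀ β : ℝ, β₅ ≤ β → ∀ L : ℕ, Λ₅ ≤ a β * L →
      (c - τ) * Q2 G r β L (a β) (thetaTest 4 v) v ≤ Q3 G r β L (a β) (thetaTest 4 v) v h := by
  intro β hβ L hL
  have hq := hnn β hβ L hL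
  have ht := hT β hβ L hL
  have hs := hS β hβ L hL
  rw [abs_le] at ht
  have : c * Q2 G r β L (a β) (thetaTest 4 v) v ≤ n β * μ β L * Q2 G r β L (a β) (thetaTest 4 v) v :=
    mul_le_mul_of_nonneg_right hs hq
  nlinarith [ht.1, this]

/-- **The sign.**  Under the slab package with `τ < c` and a strictly positive two-point floor `0 < ε ≤ Q2(θv, v)`,
`0 < Q3(θv, v, h)` — POSITIVE, opposite to the squeezed-shape sign `σ = −1` of `SkewResponse.lowerBoundsSnd_of_signed`;
the two shapes are separated by a nodal set of `Q3`. [folklore] -/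
theorem Q3_pos_of_slab (v h : 𝓢(EuclideanSpace ℝ (Fin 4), ℝ)) (n : ℝ → ℝ) (μ : ℝ → ℕ → ℝ)
    {τ c ε β₅ Λ₅ : ℝ} (hε : 0 < ε) (hτc : τ < c)
    (hfloor : ∀ β : ℝ, β₅ ≤ β → ∀ L : ℕ, Λ₅ ≤ a β * L → ε ≤ Q2 G r β L (a β) (thetaTest 4 v) v)
    (hT : ∀ β : ℝ, β₅ ≤ β → ∀ L : ℕ, Λ₅ ≤ a β * L →
      |Q3 G r β L (a β) (thetaTest 4 v) v h - n β * μ β L * Q2 G r β L (a β) (thetaTest 4 v) v| ≤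
        τ * Q2 G r β L (a β) (thetaTest 4 v) v)
    (hS : ∀ β : ℝ, β₅ ≤ β → ∀ L : ℕ, Λ₅ ≤ a β * L → c ≤ n β * μ β L) :
    ∀ β : ℝ, β₅ ≤ β → ∀ L : ℕ, Λ₅ ≤ a β * L → 0 < Q3 G r β L (a β) (thetaTest 4 v) v h := by
  intro β hβ L hL
  have hk := relSkewFloor_of_transport_of_shrinkage G r a v h n μ
    (fun β hβ L hL => hε.le.trans (hfloor β hβ L hL)) hT hS β hβ L hL
  have hq := hfloor β hβ L hL
  have : 0 < (c - τ) * Q2 G r β L (a β) (thetaTest 4 v) v := mul_pos (sub_pos.2 hτc) (hε.trans_le hq)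
  exact this.trans_le hk

/-- **A three-point floor from a relative skewness floor and the two-point floor**: `κ·Q2 ≤ Q3`, `ε ≤ Q2`, `κ, ε > 0`
(`κ > 0`) give `κε ≤ |Q3|`. [folklore] -/
theorem threePoint_floor_of_relSkewFloor (v h : 𝓢(EuclideanSpace ℝ (Fin 4), ℝ)) {ε κ β₅ Λ₅ : ℝ}
    (hκ : 0 < κ)
    (hfloor : ∀ β : ℝ, β₅ ≤ β → ∀ L : ℕ, Λ₅ ≤ a β * L → ε ≤ Q2 G r β L (a β) (thetaTest 4 v) v)
    (hrel : ∀ β : ℝ, β₅ ≤ β → ∀ L : ℕ, Λ₅ ≤ a β * L →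
      κ * Q2 G r β L (a β) (thetaTest 4 v) v ≤ Q3 G r β L (a β) (thetaTest 4 v) v h) :
    ∀ β : ℝ, β₅ ≤ β → ∀ L : ℕ, Λ₅ ≤ a β * L → κ * ε ≤ |Q3 G r β L (a β) (thetaTest 4 v) v h| := by
  intro β hβ L hL
  have hq := hfloor β hβ L hL
  have hk := hrel β hβ L hL
  rw [le_abs]
  left
  exact (mul_le_mul_of_nonneg_left hq hκ.le).trans hk

/-! ## §3 Conjunct 3 of `UVSeamRec.stub_floorsEngine` from the slab package (compact witnesses `(θv, v, h)`) -/

/-- **Conjunct 3 (three-point floor) of `stub_floorsEngine` from the conjunct-2 floor and the slab package**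
(general `(G, r, a)`): compactly supported `v` (clause-(i) witness) and slab bump `h` with `θv ⟂ v`, `v ⟂ h`, `θv ⟂ h`
(pairwise disjoint `tsupport`s), the two-point floor `ε ≤ Q2(θv, v)` (`ε > 0`), (ST) with relative error `τ` and
(MS) with `τ < c` on the same range; then the registered conjunct-3 text holds with witnesses `(θv, v, h)` and
`ε₃ = (c − τ)·ε`.  Clause (ii) costs no floor of its own here — it is clause (i) times the trace-anomaly charge of the
messenger, GIVEN the two IR inputs. [folklore] -/
theorem threePointConjunct_of_slab (v h : 𝓢(EuclideanSpace ℝ (Fin 4), ℝ))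
    (hvK : HasCompactSupport (v : EuclideanSpace ℝ (Fin 4) → ℝ))
    (hhK : HasCompactSupport (h : EuclideanSpace ℝ (Fin 4) → ℝ))
    (hd₁ : Disjoint (tsupport (thetaTest 4 v : EuclideanSpace ℝ (Fin 4) → ℝ))
      (tsupport (v : EuclideanSpace ℝ (Fin 4) → ℝ)))
    (hd₂ : Disjoint (tsupport (v : EuclideanSpace ℝ (Fin 4) → ℝ)) (tsupport (h : EuclideanSpace ℝ (Fin 4) → ℝ)))
    (hd₃ : Disjoint (tsupport (thetaTest 4 v : EuclideanSpace ℝ (Fin 4) → ℝ))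
      (tsupport (h : EuclideanSpace ℝ (Fin 4) → ℝ)))
    {ε τ c β₅ Λ₅ : ℝ} (hε : 0 < ε) (hτc : τ < c)
    (hfloor : ∀ β : ℝ, β₅ ≤ β → ∀ L : ℕ, Λ₅ ≤ a β * L → ε ≤ Q2 G r β L (a β) (thetaTest 4 v) v)
    (n : ℝ → ℝ) (μ : ℝ → ℕ → ℝ)
    (hT : ∀ β : ℝ, β₅ ≤ β → ∀ L : ℕ, Λ₅ ≤ a β * L →
      |Q3 G r β L (a β) (thetaTest 4 v) v h - n β * μ β L * Q2 G r β L (a β) (thetaTest 4 v) v| ≤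
        τ * Q2 G r β L (a β) (thetaTest 4 v) v)
    (hS : ∀ β : ℝ, β₅ ≤ β → ∀ L : ℕ, Λ₅ ≤ a β * L → c ≤ n β * μ β L) :
    ∃ (f g h : 𝓢(EuclideanSpace ℝ (Fin 4), ℝ)) (ε β₅ Λ₅ : ℝ),
      HasCompactSupport (f : EuclideanSpace ℝ (Fin 4) → ℝ) ∧
      HasCompactSupport (g : EuclideanSpace ℝ (Fin 4) → ℝ) ∧
      HasCompactSupport (h : EuclideanSpace ℝ (Fin 4) → ℝ) ∧
      Disjoint (tsupport (f : EuclideanSpace ℝ (Fin 4) → ℝ)) (tsupport (g : EuclideanSpace ℝ (Fin 4) → ℝ)) ∧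
      Disjoint (tsupport (g : EuclideanSpace ℝ (Fin 4) → ℝ)) (tsupport (h : EuclideanSpace ℝ (Fin 4) → ℝ)) ∧
      Disjoint (tsupport (f : EuclideanSpace ℝ (Fin 4) → ℝ)) (tsupport (h : EuclideanSpace ℝ (Fin 4) → ℝ)) ∧
      0 < ε ∧ ∀ β : ℝ, β₅ ≤ β → ∀ L : ℕ, Λ₅ ≤ a β * L → ε ≤ |Q3 G r β L (a β) f g h| :=
  ⟨thetaTest 4 v, v, h, (c - τ) * ε, β₅, Λ₅, hasCompactSupport_thetaTest hvK, hvK, hhK, hd₁, hd₂, hd₃,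
    mul_pos (sub_pos.2 hτc) hε,
    threePoint_floor_of_relSkewFloor G r a v h (sub_pos.2 hτc) hfloor
      (relSkewFloor_of_transport_of_shrinkage G r a v h n μ (fun β hβ L hL => hε.le.trans (hfloor β hβ L hL)) hT hS)⟩

end Torus

end Summit.QuantumFields.YangMills.Cruxes.NT.SlabSkewness

end
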